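import Mathlib
import HarnessLib
import Summits.Ventures.LatticeQCDFlow.Exactness.LatentReversibleProposals

/-!
# LatticeQCDFlow / Exactness — PARTIAL LATENT REFRESH: redrawing ONE BLOCK of latent coordinates from the base law (the rest frozen) is
# reversible for a product base, so the partial refresh read through the flow and accepted with the plain importance ratio is exact

HONEST FRAMING: exact (Metropolis-corrected) sampling algorithms for lattice gauge theory;
figures of merit are autocorrelation/cost numbers at stated couplings and volumes; no
continuum-physics claim.

Venture `LatticeQCDFlow` (cell pub-lqcd), topic `Exactness`, FANOUT row 30 (lean-1 GEN-43, part II: MOVES IN FLOW SPACE; supplies the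
`γ`-reversibility hypothesis of `LatentReversibleProposals` for block refreshes of a product base).  NEW WORK of the cell over Mathlib's
product measures (`Measure.prod`, `lintegral_prod`, `measurable_measure_prodMk_left`); no definition is introduced, nothing is cited as a
fact.  Printed counterparts NAMED ONLY: partial ∕ block resampling of the latent noise in flow-based samplers ("partial refresh", e.g.
Gabrié–Rotskoff–Vanden-Eijnden 2022 SI; the lattice practice of refreshing a subset of the flow's noise variables); random-scan Gibbs
reversibility is classical.  The tree's `BlockFlowConditionalExact` conditions the FLOW on a frozen block of the FIELD; here the block is
in LATENT space and the flow is unconditional.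

## Setting and results [all ours]

Latent space `Z₁ × Z₂` with PRODUCT base `γ = γ₁ ⊗ γ₂` (independent blocks of noise: both probability laws); the BLOCK REFRESH, def-free:
ANY kernel `S` on `Z₁ × Z₂` with `S((z₁, z₂), B) = γ₂({z₂′ : (z₁, z₂′) ∈ B})` — keep block 1, redraw block 2 from its base law.

* **`blockRefresh_setLIntegral`**: `∫_A S(z, B) dγ = ∫ γ₂(A_{z₁})·γ₂(B_{z₁}) γ₁(dz₁)` (sections `A_{z₁} = {z₂ : (z₁, z₂) ∈ A}`).
* **`blockRefresh_isReversible`**: `S` is `γ`-reversible (the right-hand side is symmetric in `A ↔ B`); `blockRefresh_apply_univ`: Markov.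
* **`blockRefreshProposal_invariant`**: for every flow bijection `e : Z₁ × Z₂ ≃ᵐ Ω`, flow law `q = γ.map e`, positive measurable weight
  `w`: ANY kernel realising "pull back, redraw the second noise block, push forward, accept with `min(1, w(y)/w(x))`, else stay" leaves
  `π = w·q` invariant (`latentProposal_invariant`).  By symmetry of the roles the same holds for the first block; alternating the two
  (a systematic partial-refresh sweep) is exact by composition of exact kernels.
-/

namespace Summit.Ventures.LatticeQCDFlow.Exactness

open MeasureTheory ProbabilityTheory
open scoped ENNReal

variable {Z₁ Z₂ : Type*} [MeasurableSpace Z₁] [MeasurableSpace Z₂] {γ₁ : Measure Z₁} {γ₂ : Measure Z₂}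
  [IsProbabilityMeasure γ₁] [IsProbabilityMeasure γ₂]

/-! ## §1 The block refresh is reversible for the product base -/

omit [IsProbabilityMeasure γ₁] in
/-- **THE MASS FLOW OF THE BLOCK REFRESH**: `∫_A S(z, B) d(γ₁ ⊗ γ₂) = ∫ γ₂(A_{z₁})·γ₂(B_{z₁}) γ₁(dz₁)`. [ours] -/
theorem blockRefresh_setLIntegral [SFinite γ₁] (S : Kernel (Z₁ × Z₂) (Z₁ × Z₂))
    (hS : ∀ (z : Z₁ × Z₂) {B : Set (Z₁ × Z₂)}, MeasurableSet B → S z B = γ₂ (Prod.mk z.1 ⁻¹' B))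
    {A B : Set (Z₁ × Z₂)} (hA : MeasurableSet A) (hB : MeasurableSet B) :
    ∫⁻ z in A, S z B ∂(γ₁.prod γ₂) = ∫⁻ z₁, γ₂ (Prod.mk z₁ ⁻¹' A) * γ₂ (Prod.mk z₁ ⁻¹' B) ∂γ₁ := by
  have hG : Measurable fun z : Z₁ × Z₂ => γ₂ (Prod.mk z.1 ⁻¹' B) := (measurable_measure_prodMk_left hB).comp measurable_fst
  simp_rw [hS _ hB]
  rw [← lintegral_indicator hA, lintegral_prod _ ((hG.indicator hA).aemeasurable)]
  refine lintegral_congr fun z₁ => ?_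
  have hpt : ∀ z₂, A.indicator (fun z : Z₁ × Z₂ => γ₂ (Prod.mk z.1 ⁻¹' B)) (z₁, z₂) =
      (Prod.mk z₁ ⁻¹' A).indicator (fun _ => γ₂ (Prod.mk z₁ ⁻¹' B)) z₂ := fun z₂ => by
    by_cases h : (z₁, z₂) ∈ A
    · rw [Set.indicator_of_mem h, Set.indicator_of_mem (Set.mem_preimage.2 h)]
    · rw [Set.indicator_of_notMem h, Set.indicator_of_notMem (fun h' => h (Set.mem_preimage.1 h'))]
  simp_rw [hpt]
  rw [lintegral_indicator_const (measurable_prodMk_left hA), mul_comm]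

/-- **THE BLOCK REFRESH IS `γ₁ ⊗ γ₂`-REVERSIBLE.** [ours] -/
theorem blockRefresh_isReversible (S : Kernel (Z₁ × Z₂) (Z₁ × Z₂))
    (hS : ∀ (z : Z₁ × Z₂) {B : Set (Z₁ × Z₂)}, MeasurableSet B → S z B = γ₂ (Prod.mk z.1 ⁻¹' B)) :
    Kernel.IsReversible S (γ₁.prod γ₂) := by
  intro A B hA hB
  rw [blockRefresh_setLIntegral S hS hA hB, blockRefresh_setLIntegral S hS hB hA]
  exact lintegral_congr fun z₁ => mul_comm _ _

omit [IsProbabilityMeasure γ₁] in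
/-- `S(z, Z₁ × Z₂) = 1`. [ours, bookkeeping] -/
theorem blockRefresh_apply_univ (S : Kernel (Z₁ × Z₂) (Z₁ × Z₂))
    (hS : ∀ (z : Z₁ × Z₂) {B : Set (Z₁ × Z₂)}, MeasurableSet B → S z B = γ₂ (Prod.mk z.1 ⁻¹' B)) (z : Z₁ × Z₂) :
    S z Set.univ = 1 := by
  rw [hS z MeasurableSet.univ, Set.preimage_univ, measure_univ]

omit [IsProbabilityMeasure γ₁] in
/-- Hence the block refresh is Markov. [ours, bookkeeping] -/
theorem blockRefresh_isMarkovKernel (S : Kernel (Z₁ × Z₂) (Z₁ × Z₂))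
    (hS : ∀ (z : Z₁ × Z₂) {B : Set (Z₁ × Z₂)}, MeasurableSet B → S z B = γ₂ (Prod.mk z.1 ⁻¹' B)) : IsMarkovKernel S :=
  ⟨fun z => ⟨blockRefresh_apply_univ S hS z⟩⟩

omit [IsProbabilityMeasure γ₁] in
/-- The block refresh exists as a kernel: `z ↦ (δ_{z₁}) ⊗ γ₂`. [ours, remark] -/
theorem blockRefresh_exists :
    ∃ S : Kernel (Z₁ × Z₂) (Z₁ × Z₂), ∀ (z : Z₁ × Z₂) {B : Set (Z₁ × Z₂)}, MeasurableSet B → S z B = γ₂ (Prod.mk z.1 ⁻¹' B) := by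
  refine ⟨((Kernel.deterministic Prod.fst measurable_fst : Kernel (Z₁ × Z₂) Z₁) ×ₖ Kernel.const (Z₁ × Z₂) γ₂), fun z B hB => ?_⟩
  rw [Kernel.prod_apply, Kernel.deterministic_apply, Kernel.const_apply, Measure.dirac_prod, Measure.map_apply measurable_prodMk_left hB]

/-! ## §2 The partial refresh through the flow is exact -/

variable {Ω : Type*} [MeasurableSpace Ω] {w : Ω → ℝ}

/-- **PARTIAL LATENT REFRESH THROUGH THE FLOW IS EXACT**: flow bijection `e : Z₁ × Z₂ ≃ᵐ Ω`, flow law `q = (γ₁ ⊗ γ₂).map e`, weight `w > 0`;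
redraw the second noise block from `γ₂`, push forward, accept with `min(1, w(y)/w(x))`: `π = w·q` is invariant. [ours] -/
theorem blockRefreshProposal_invariant (hw : Measurable w) (hw0 : ∀ x, 0 < w x) (e : Z₁ × Z₂ ≃ᵐ Ω)
    (S : Kernel (Z₁ × Z₂) (Z₁ × Z₂))
    (hS : ∀ (z : Z₁ × Z₂) {B : Set (Z₁ × Z₂)}, MeasurableSet B → S z B = γ₂ (Prod.mk z.1 ⁻¹' B)) (R : Kernel Ω Ω)
    (hR : ∀ (x : Ω) {B : Set Ω}, MeasurableSet B → R x B = S (e.symm x) (e ⁻¹' B)) (K : Kernel Ω Ω)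
    (hK : ∀ (x : Ω) {B : Set Ω}, MeasurableSet B → K x B =
      ∫⁻ y in B, imhAcceptE w x y ∂(R x) + (1 - ∫⁻ y, imhAcceptE w x y ∂(R x)) * B.indicator 1 x) :
    Kernel.Invariant K (((γ₁.prod γ₂).map e).withDensity fun x => ENNReal.ofReal (w x)) := by
  haveI := blockRefresh_isMarkovKernel S hS
  exact latentProposal_invariant hw hw0 e S (blockRefresh_isReversible S hS) R hR K hK

/-- … and so is its detailed balance: the partial-refresh flow sampler is `π`-reversible. [ours] -/
theorem blockRefreshProposal_isReversible (hw : Measurable w) (hw0 : ∀ x, 0 < w x) (e : Z₁ × Z₂ ≃ᵐ Ω)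
    (S : Kernel (Z₁ × Z₂) (Z₁ × Z₂))
    (hS : ∀ (z : Z₁ × Z₂) {B : Set (Z₁ × Z₂)}, MeasurableSet B → S z B = γ₂ (Prod.mk z.1 ⁻¹' B)) (R : Kernel Ω Ω)
    (hR : ∀ (x : Ω) {B : Set Ω}, MeasurableSet B → R x B = S (e.symm x) (e ⁻¹' B)) (K : Kernel Ω Ω)
    (hK : ∀ (x : Ω) {B : Set Ω}, MeasurableSet B → K x B =
      ∫⁻ y in B, imhAcceptE w x y ∂(R x) + (1 - ∫⁻ y, imhAcceptE w x y ∂(R x)) * B.indicator 1 x) :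
    Kernel.IsReversible K (((γ₁.prod γ₂).map e).withDensity fun x => ENNReal.ofReal (w x)) := by
  haveI := blockRefresh_isMarkovKernel S hS
  exact latentProposal_isReversible hw hw0 e S (blockRefresh_isReversible S hS) R hR K hK

end Summit.Ventures.LatticeQCDFlow.Exactness
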